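import Mathlib.LinearAlgebra.UnitaryGroup
import Mathlib.LinearAlgebra.Matrix.GeneralLinearGroup.Defs
import Mathlib.Analysis.Complex.Basic
import Mathlib.Algebra.Star.Rat
import Mathlib.Data.Set.Finite.Basic
import HarnessLib

/-!
# Barrier catalogue `QuantumAdvantage` — lattice rigidity of the Toffoli+Hadamard gate group

Topic `Literature/Barriers/QuantumAdvantage` (D-0021). Summit statement:
`QuantumAdvantage := ∃ L, L ∈ BQP ∧ L ∉ BPP`.

BARRIER: technique_class := classical simulation / dequantisation schemes for `n`-qubit
  Toffoli+Hadamard circuits that FACTOR THROUGH A COMPRESSED LINEAR SHADOW OF THE GATE GROUP —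
  a group homomorphism `ρ : Γ_{2ⁿ} →* GL_d(ℂ)` with `d < 2ⁿ` (track `ρ(circuit)` instead of the
  `2ⁿ × 2ⁿ` operator; `LinearShadow`, `FactorsThrough` below), where
  `Γ_N = O_N(ℤ[1/2])` (`dyadicOrthogonalGroup N`) is exactly the group of operators exactly
  represented by circuits over `{X, CX, CCX, H ⊗ H}` with one ancilla
  [cite: AmyGlaudellRoss2020, §1 Theorem (i)]; this is the algebraic form of the two classical
  islands — stabiliser circuits are simulated through the action of the Clifford group on the
  `2n` (de)stabiliser Pauli generators (tableaux) [cite: AaronsonGottesman2004, §III (arXiv §3), tableau algorithm],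
  and matchgate circuits of width `n` are equivalent to unitary computations on `O(log n)`
  qubits, the compression going through the `2n`-dimensional rotation `R ∈ SO(2n, ℝ)` attached
  to each matchgate circuit [cite: JozsaEtAl2009, (abstract), §2 (eq. for U† c_j U) and §3];
  blocks := every such scheme for `n ≥ 3` qubits: the shadow has FINITE image
  (`latticeRigidity_finiteImage`), hence any quantity computed from it takes only finitely many
  values over all circuits (`latticeRigidity_finiteImage.finite_range_of_factorsThrough`) and
  `ρ` identifies all circuits outside finitely many classes; in particular there is no
  homomorphic simulation of `n`-qubit Toffoli+Hadamard operators by unitaries on `m < n` qubits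
  (`latticeRigidity_finiteImage.finite_range_qubits`) and none on `d < 2ⁿ` classical linear
  dimensions with infinite image — the universal real gate group has no analogue of the
  tableau / matchgate modules below dimension `2ⁿ` [derived from the theorems cited under
  `because`; the reading for `{X, CX, CCX, H⊗H}` circuits is via AmyGlaudellRoss2020, §1 Theorem (i)];
  because := NAMED FACT `latticeRigidity_finiteImage`, a corollary ASSEMBLED from printed
  theorems (the assembly is spelled out here; it is not printed verbatim in the sources read):
  (1) `SO_N(ℤ[1/2])` (index `2` in `Γ_N`) is the `S`-arithmetic subgroup `G(ℚ(S))`,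
  `S = {∞, 2}`, `ℚ(S) = ℤ[1/2]`, of the connected absolutely almost simple `ℚ`-group
  `G = SO(q_N)`, `q_N = x₁² + ⋯ + x_N²`, `N = 2ⁿ ≥ 8` (type `D_{N/2}`); `G(ℝ)` is compact, so the
  standing hypothesis `S ⊇ ℛ_∞ ∖ 𝒯` of Margulis' Chapter VIII holds
  [cite: Margulis1991, Ch. VIII, introduction (notation `K(S)`, `H(K(S))`, `S`-arithmetic, `𝒯`, `rank_S`)];
  (2) `rank_S G = rank_{ℚ₂} SO(q_N) =` Witt index of `q_N ⊗ ℚ₂`, which is `≥ 2` because every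
  quadratic space of dimension `≥ 5` over a local field is isotropic [cite: Omeara1963, 63:19]
  (in fact `8·⟨1⟩` is hyperbolic over `ℚ₂`: `-1 = u² + 1 + 1 + 4` with `u² = -7`, `u ∈ ℤ₂`);
  (3) for `Λ` in Margulis' class `Ω_S` (which contains the `S`-arithmetic subgroups and their
  finite-index subgroups since `2 ∉ 𝒯`), any field `l` of characteristic `0` and any homomorphism
  `δ : Λ → H(l)` into an algebraic `l`-group, `rank_S G ≥ 2` forces the Zariski closure of
  `δ(Λ)` to be semisimple [cite: Margulis1991, Ch. VIII Theorem (B)(ii) and Theorem 3.10];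
  (4) if that closure had non-trivial identity component `H°`, composing with an adjoint simple
  quotient `H° ↠ H₁` gives a Zariski-dense homomorphism of the finite-index subgroup
  `Λ' = δ⁻¹(H°)` into a connected absolutely almost simple adjoint group, which by Margulis'
  Theorem (C) is `λ ↦ ν(λ)·η(σ⁰(λ))` with `σ : ℚ → l` the field embedding, `η : G → H₁` a special
  `l`-epimorphism [cite: Margulis1991, Ch. I (1.4.14)] — for the absolutely almost simple `G = SO_N`
  in characteristic `0` an isogeny, hence central — and `ν` valued in the (trivial) centre of the
  adjoint group `H₁` [cite: Margulis1991, Ch. VIII Theorem (C) and Theorem 3.4(a),(b)];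
  (5) then the simply connected cover `Spin_N(ℂ)` of `H₁` acts non-trivially on `ℂ^d`
  (`H° ⊂ GL_d` acts faithfully), producing a non-trivial irreducible representation of
  `𝔰𝔬_N ℂ` of dimension `≤ d < N`; but non-trivial irreducible representations of smallest
  dimension are among the fundamental ones [cite: FultonHarrisGTM129, Exercise 24.9], and for
  `𝔰𝔬_{2m} ℂ`, `m = N/2 ≥ 4`, these are `Λᵏ ℂ^{2m}` (`1 ≤ k ≤ m-2`, dimension `C(2m,k) ≥ 2m`) and
  the two half-spin representations (dimension `2^{m-1} ≥ 2m`)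
  [cite: FultonHarrisGTM129, §19.2 (fundamental weights), Theorem 19.2 and Proposition 20.15];
  so `H° = 1`, the Zariski closure of `δ(Λ)` is finite, and `ρ(Γ_N)` (two cosets of `Λ`) is finite;
  evasions_known := (a) shadows of dimension `≥ 2ⁿ` — the bound is tight: the defining
  representation, and for `N = 8` the two further `8`-dimensional (half-spin) representations
  permuted by triality [cite: FultonHarrisGTM129, §20.3]; (b) NON-homomorphic simulations — a
  scheme whose state depends on the circuit word and not only on the operator it implements
  (stabiliser-rank decompositions, tensor-network contraction, quasi-probability sampling, …) is
  not a homomorphism of `Γ_N` and is untouched (no source claims otherwise; compare the analytic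
  entries `BoundedEntanglement`, `TensorNetworkContraction` of this catalogue);
  (c) non-universal gate groups, which do carry small faithful modules — Clifford/stabiliser
  [cite: AaronsonGottesman2004, §III (arXiv §3)] and matchgates [cite: JozsaEtAl2009, §2];
  (d) `n ≤ 2`: `Γ_4 = O_4(ℤ[1/2])` is FINITE — a dyadic column of norm `1` has all entries in
  `{0, ±1/2, ±1}` because `a² + b² + c² + d² ≡ 0 (mod 8)` forces `a, b, c, d` even (proved in the
  companion file `LatticeRigidityWitnesses`; the `2`-adic reading is that `⟨1,1,1,1⟩` is the
  anisotropic quaternary space over `ℚ₂` [cite: Omeara1963, 63:17 and 63:18]), so nothing is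
  claimed below three qubits and the rank hypothesis of (2) genuinely needs `N ≥ 5`;
  scope_caveats := (a) EXACT homomorphisms only — an `ε`-approximate version
  (almost-homomorphisms into `U(d)`, uniform stability of `Γ_N`) is NOT claimed: stability of
  higher-rank lattices is in print for lattices in real semisimple groups, not for this
  `2`-adic, definite-at-`∞` case; (b) targets over `ℂ` (hence its subfields and `U(d)`) only;
  positive-characteristic targets — where [cite: Margulis1991, Ch. VIII Theorem (B)(i)] gives
  finiteness in every dimension for `S`-arithmetic subgroups of the simply connected cover — are
  not vendored; (c) homomorphisms to FINITE groups are trivially of finite image; the sharper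
  statement that they factor through congruence quotients `O_N(ℤ/m)` (congruence subgroup
  property of spin groups over `ℤ[1/2]`) is a different theorem, NOT vendored (D-0026: one fact
  per entry); (d) the statement is about the matrix group `Γ_{2ⁿ}`; its identification with
  `{X, CX, CCX, H⊗H}`-circuits (one ancilla) is [cite: AmyGlaudellRoss2020, §1 Theorem (i)] and
  is not re-proved here; circuits over `{X, CX, CCX, H}` realise the larger group
  `O_N(ℤ[1/√2])` [cite: AmyGlaudellRoss2020, §1 Corollary (i)], an `S`-arithmetic group over
  `ℚ(√2)` containing `Γ_N`, for which nothing is stated here; (e) infinitude of `Γ_N` for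
  `N ≥ 5` and finiteness of `Γ_4`, which make the statement visibly non-vacuous / sharp, are
  proved in the companion file `LatticeRigidityWitnesses`, not assumed;
  status := established ingredients ([cite: Margulis1991, Ch. VIII Theorems (B), (C)],
  [cite: Omeara1963, 63:19], [cite: FultonHarrisGTM129, Exercise 24.9]); the corollary as typed is
  an assembly of them (steps (1)–(5) above), not located verbatim in print (searches: the idea
  card `superrigid-gate-lattice` and its novelty audit; this session zbMATH "superrigidity
  quantum gates" (0 hits) and Crossref "superrigidity quantum circuits simulation" (8 hits, none
  relevant); Margulis / O'Meara / Fulton–Harris / AGR20 / JKMW10 / AG04 read at the locators given).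

## Contents

* `dyadicRationals` — the ring `𝔻 = ℤ[1/2] ⊂ ℚ` of dyadic fractions.
* `dyadicOrthogonalGroup N` — `Γ_N = O_N(ℤ[1/2])`, the orthogonal `N × N` rational matrices with
  dyadic entries, as a subgroup of `Matrix.orthogonalGroup (Fin N) ℚ`;
  `toffoliHadamardGroup n := Γ_{2ⁿ}` (the `n`-qubit Toffoli+Hadamard gate group).
* `LinearShadow n d` — the technique class: homomorphisms `Γ_{2ⁿ} →* GL_d(ℂ)`;
  `FactorsThrough f ρ` — a function of circuits/operators that is computed from the shadow.
* `latticeRigidity_finiteImage` — THE BARRIER (named fact): for `n ≥ 3` and `d < 2ⁿ` every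
  linear shadow has finite image.
* Proved consequences: `….finite_range_of_factorsThrough`, `….finite_range_unitary`,
  `….finite_range_qubits`, `….not_injective_of_infinite`.

## Design notes

* `Γ_N` is realised inside `O_N(ℚ)` (Mathlib's `Matrix.orthogonalGroup` over `ℚ`, trivial star)
  by the entrywise condition "dyadic", literally Amy–Glaudell–Ross' `U_N(𝔻)`, `𝔻 = ℤ[1/2]`; this
  avoids a `StarRing` instance on `Localization.Away (2 : ℤ)`. `lean search`: Mathlib has no
  `Dyadic` subring of `ℚ`, no `S`-arithmetic groups, no superrigidity; the tree's gate set
  `Literature.Computability.Cryptography.toffoliH = {H, X, CNOT, TOF}` produces matrices over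
  `ℤ[1/√2]` (single `H`), see `scope_caveats` (d) — no dependence on the circuit library is needed
  for the group-theoretic statement, so none is imported.
* Targets are `GL (Fin d) ℂ = (Matrix (Fin d) (Fin d) ℂ)ˣ`; unitary targets embed by
  `Unitary.toUnits`.
* One named fact only (D-0026); everything else in this file is a definition with a body or a
  proved statement.

## References

* [Margulis1991] G. A. Margulis, *Discrete Subgroups of Semisimple Lie Groups*, Springer (1991):
  Ch. VIII, introduction (Theorems (A), (B), (C)), §3 (class `Ω_S`, Lemma 3.1, Theorems 3.4,
  3.10, 3.12). Read via `lit read book:margulis1991-discrete-subgroups-semisimple-lie-groups`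
  (PDF pp. 324–325, 343–357).
* [AmyGlaudellRoss2020] M. Amy, A. N. Glaudell, N. J. Ross, *Number-theoretic characterizations
  of some restricted Clifford+T circuits*, Quantum 4 (2020) 252 (arXiv:1908.06076): §1, Theorem
  and Corollaries. Read via `lit read arxiv:1908.06076` pp. 1–4.
* [Omeara1963] O. T. O'Meara, *Introduction to Quadratic Forms* (1963): 63:17–63:19.
* [FultonHarrisGTM129] W. Fulton, J. Harris, *Representation Theory* (1991): §19.2 (Theorem 19.2),
  §20.1 (Proposition 20.15), §20.3, Exercise 24.9.
* [JozsaEtAl2009] R. Jozsa, B. Kraus, A. Miyake, J. Watrous, *Matchgate and space-bounded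
  quantum computations are equivalent*, Proc. R. Soc. A 466 (2010) (arXiv:0908.1467): abstract,
  §2, §3. Read via `lit read arxiv:0908.1467`.
* [AaronsonGottesman2004] S. Aaronson, D. Gottesman, *Improved simulation of stabilizer
  circuits*, Phys. Rev. A 70 (2004) (arXiv:quant-ph/0406196): §III = arXiv §3 (tableau
  algorithm). Read via `lit read arxiv:quant-ph/0406196`.
-/

noncomputable section

open Matrix

namespace Literature.Barriers.QuantumAdvantage

/-! ### The ring `𝔻 = ℤ[1/2]` and the group `Γ_N = O_N(ℤ[1/2])` -/

/-- The ring `𝔻 = ℤ[1/2]` of dyadic fractions `a / 2ᵏ` (`a ∈ ℤ`, `k ∈ ℕ`), as a subring of `ℚ`.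
[cite: AmyGlaudellRoss2020, §1 (the ring 𝔻 = ℤ[1/2])] -/
def dyadicRationals : Subring ℚ where
  carrier := {q | ∃ (a : ℤ) (k : ℕ), q = a / 2 ^ k}
  mul_mem' := by
    rintro _ _ ⟨a, k, rfl⟩ ⟨b, l, rfl⟩
    exact ⟨a * b, k + l, by push_cast; rw [pow_add]; field_simp⟩
  one_mem' := ⟨1, 0, by norm_num⟩
  add_mem' := by
    rintro _ _ ⟨a, k, rfl⟩ ⟨b, l, rfl⟩
    exact ⟨a * 2 ^ l + b * 2 ^ k, k + l, by push_cast; rw [pow_add]; field_simp⟩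
  zero_mem' := ⟨0, 0, by norm_num⟩
  neg_mem' := by
    rintro _ ⟨a, k, rfl⟩
    exact ⟨-a, k, by push_cast; ring⟩

/-- Membership in `𝔻 = ℤ[1/2]` (definitional unfolding). [cite: AmyGlaudellRoss2020, §1] -/
theorem mem_dyadicRationals_iff {q : ℚ} : q ∈ dyadicRationals ↔ ∃ (a : ℤ) (k : ℕ), q = a / 2 ^ k :=
  Iff.rfl

/-- Integers are dyadic fractions. [cite: AmyGlaudellRoss2020, §1] -/
theorem intCast_mem_dyadicRationals (a : ℤ) : (a : ℚ) ∈ dyadicRationals := ⟨a, 0, by simp⟩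

/-- `a / 2ᵏ ∈ 𝔻`. [cite: AmyGlaudellRoss2020, §1] -/
theorem div_two_pow_mem_dyadicRationals (a : ℤ) (k : ℕ) : (a : ℚ) / 2 ^ k ∈ dyadicRationals :=
  ⟨a, k, rfl⟩

/-- **`Γ_N = O_N(ℤ[1/2])`**: the group of orthogonal `N × N` rational matrices all of whose entries
are dyadic fractions (Amy–Glaudell–Ross' `U_N(𝔻)`: a real unitary is orthogonal), as a subgroup of
`O_N(ℚ) = Matrix.orthogonalGroup (Fin N) ℚ`. For `N = 2ⁿ` this is exactly the group of operators
of `n`-qubit circuits over `{X, CX, CCX, H ⊗ H}` with one ancilla.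
[cite: AmyGlaudellRoss2020, §1 Theorem (i)] -/
def dyadicOrthogonalGroup (N : ℕ) : Subgroup (Matrix.orthogonalGroup (Fin N) ℚ) where
  carrier := {A | ∀ i j, (A : Matrix (Fin N) (Fin N) ℚ) i j ∈ dyadicRationals}
  mul_mem' := by
    intro A B hA hB i j
    simp only [Matrix.UnitaryGroup.mul_apply, Matrix.mul_apply]
    exact Subring.sum_mem _ fun k _ => Subring.mul_mem _ (hA i k) (hB k j)
  one_mem' := by
    intro i j
    simp only [Matrix.UnitaryGroup.one_apply, Matrix.one_apply]
    split_ifs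
    · exact Subring.one_mem _
    · exact Subring.zero_mem _
  inv_mem' := by
    intro A hA i j
    simp only [Matrix.UnitaryGroup.inv_apply, Matrix.star_apply, star_trivial]
    exact hA j i

/-- Membership in `Γ_N`: all entries dyadic (definitional unfolding). [cite: AmyGlaudellRoss2020, §1 Theorem (i)] -/
theorem mem_dyadicOrthogonalGroup_iff {N : ℕ} {A : Matrix.orthogonalGroup (Fin N) ℚ} :
    A ∈ dyadicOrthogonalGroup N ↔ ∀ i j, (A : Matrix (Fin N) (Fin N) ℚ) i j ∈ dyadicRationals :=
  Iff.rfl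

/-- Constructor for elements of `Γ_N` from a rational matrix with `A * Aᵀ = 1` and dyadic entries.
[cite: AmyGlaudellRoss2020, §1 Theorem (i)] -/
def dyadicOrthogonalGroup.mkOfMatrix {N : ℕ} (A : Matrix (Fin N) (Fin N) ℚ) (horth : A * Aᵀ = 1)
    (hdy : ∀ i j, A i j ∈ dyadicRationals) : dyadicOrthogonalGroup N :=
  ⟨⟨A, (Matrix.mem_orthogonalGroup_iff (Fin N) ℚ).2 horth⟩, hdy⟩

/-- The underlying matrix of `mkOfMatrix A _ _` is `A`. [cite: AmyGlaudellRoss2020, §1 Theorem (i)] -/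
@[simp]
theorem dyadicOrthogonalGroup.coe_mkOfMatrix {N : ℕ} (A : Matrix (Fin N) (Fin N) ℚ)
    (horth : A * Aᵀ = 1) (hdy : ∀ i j, A i j ∈ dyadicRationals) :
    ((dyadicOrthogonalGroup.mkOfMatrix A horth hdy : Matrix.orthogonalGroup (Fin N) ℚ) :
      Matrix (Fin N) (Fin N) ℚ) = A :=
  rfl

/-- **The `n`-qubit Toffoli+Hadamard gate group** `Γ_{2ⁿ} = O_{2ⁿ}(ℤ[1/2])`: the operators exactly
represented by `n`-qubit circuits over `{X, CX, CCX, H ⊗ H}` with one ancilla (a computationally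
universal real gate set). [cite: AmyGlaudellRoss2020, §1 Theorem (i)] -/
abbrev toffoliHadamardGroup (n : ℕ) : Subgroup (Matrix.orthogonalGroup (Fin (2 ^ n)) ℚ) :=
  dyadicOrthogonalGroup (2 ^ n)

/-! ### The technique class: compressed linear shadows of the gate group -/

/-- A **linear shadow of dimension `d`** of `n`-qubit Toffoli+Hadamard dynamics: a group
homomorphism `ρ : Γ_{2ⁿ} →* GL_d(ℂ)` — the algebraic form of a tableau / compressed simulation,
which tracks `ρ(U)` in place of the `2ⁿ × 2ⁿ` operator `U`. It is *compressed* when `d < 2ⁿ`.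
[cite: JozsaEtAl2009, §1 (compressed simulation of matchgates via the 2n-dimensional representation)] -/
abbrev LinearShadow (n d : ℕ) : Type :=
  toffoliHadamardGroup n →* GL (Fin d) ℂ

/-- A function `f` of the operator (e.g. an output statistic of a simulation scheme) **factors
through** the shadow `ρ` if it is computed from `ρ(U)` alone: `f = g ∘ ρ` for some `g`.
[cite: JozsaEtAl2009, §1] -/
def FactorsThrough {n d : ℕ} {β : Type*} (f : toffoliHadamardGroup n → β) (ρ : LinearShadow n d) :
    Prop :=
  ∃ g : GL (Fin d) ℂ → β, f = g ∘ ρ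

/-- `ρ` itself factors through `ρ`. [cite: JozsaEtAl2009, §1] -/
theorem factorsThrough_self {n d : ℕ} (ρ : LinearShadow n d) : FactorsThrough ρ ρ :=
  ⟨id, rfl⟩

/-! ### The barrier (named fact) -/

/-- **Lattice rigidity of the Toffoli+Hadamard gate group (finite image below dimension `2ⁿ`).**
For `n ≥ 3` and `d < 2ⁿ`, every group homomorphism `ρ : O_{2ⁿ}(ℤ[1/2]) →* GL_d(ℂ)` has finite
image. Corollary assembled from: Margulis' superrigidity theorems for `S`-arithmetic subgroups of
`S`-rank `≥ 2` in characteristic `0` — semisimplicity of the Zariski closure and algebraicity of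
Zariski-dense homomorphisms into absolutely almost simple groups
[cite: Margulis1991, Ch. VIII Theorems (B)(ii), (C); Theorems 3.4, 3.10] — applied to
`SO_{2ⁿ}(ℤ[1/2])`, `S = {∞, 2}`, whose `2`-adic rank is the Witt index `≥ 2` of `x₁² + ⋯ + x_N²`
over `ℚ₂` [cite: Omeara1963, 63:19], together with the fact that `𝔰𝔬_N ℂ` (`N = 2ⁿ ≥ 8`) has no
non-trivial representation of dimension `< N` [cite: FultonHarrisGTM129, Exercise 24.9, Theorem 19.2, Proposition 20.15].
See the module docstring, `because` (1)–(5), for the assembly; the statement is not printed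
verbatim in these sources. [cite: Margulis1991, Ch. VIII Theorems (B) and (C)] -/
def latticeRigidity_finiteImage : Prop :=
  ∀ (n : ℕ), 3 ≤ n → ∀ (d : ℕ), d < 2 ^ n →
    ∀ ρ : toffoliHadamardGroup n →* GL (Fin d) ℂ, (Set.range ρ).Finite

/-! ### Consequences of the barrier (proved from the named fact) -/

/-- READING 1 (finitely many values): for `n ≥ 3`, anything computed from a compressed linear
shadow — any `f` factoring through some `ρ : Γ_{2ⁿ} →* GL_d(ℂ)`, `d < 2ⁿ` — takes only finitely
many values over the whole gate group. [cite: Margulis1991, Ch. VIII Theorems (B) and (C)] -/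
theorem latticeRigidity_finiteImage.finite_range_of_factorsThrough (h : latticeRigidity_finiteImage)
    {n d : ℕ} (hn : 3 ≤ n) (hd : d < 2 ^ n) {β : Type*} {f : toffoliHadamardGroup n → β}
    {ρ : LinearShadow n d} (hf : FactorsThrough f ρ) : (Set.range f).Finite := by
  obtain ⟨g, rfl⟩ := hf
  rw [Set.range_comp]
  exact (h n hn d hd ρ).image g

/-- READING 2 (no compressed unitary shadow): for `n ≥ 3` and `d < 2ⁿ`, every homomorphism
`Γ_{2ⁿ} →* U(d)` has finite image. [cite: Margulis1991, Ch. VIII Theorems (B) and (C)] -/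
theorem latticeRigidity_finiteImage.finite_range_unitary (h : latticeRigidity_finiteImage)
    {n d : ℕ} (hn : 3 ≤ n) (hd : d < 2 ^ n)
    (ρ : toffoliHadamardGroup n →* Matrix.unitaryGroup (Fin d) ℂ) : (Set.range ρ).Finite := by
  have hfin := h n hn d hd ((Unitary.toUnits).comp ρ)
  rw [MonoidHom.coe_comp, Set.range_comp] at hfin
  exact Set.Finite.of_finite_image hfin (Unitary.toUnits_injective.injOn)

/-- READING 3 (not on fewer qubits): for `m < n` and `n ≥ 3`, every homomorphism from the
`n`-qubit Toffoli+Hadamard gate group to the unitary group `U(2ᵐ)` of an `m`-qubit register has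
finite image — no faithful homomorphic re-encoding of `n`-qubit universal real dynamics into
`m < n` qubits. [cite: Margulis1991, Ch. VIII Theorems (B) and (C)] -/
theorem latticeRigidity_finiteImage.finite_range_qubits (h : latticeRigidity_finiteImage)
    {n m : ℕ} (hn : 3 ≤ n) (hm : m < n)
    (ρ : toffoliHadamardGroup n →* Matrix.unitaryGroup (Fin (2 ^ m)) ℂ) : (Set.range ρ).Finite :=
  h.finite_range_unitary hn (Nat.pow_lt_pow_right (by norm_num) hm) ρ

/-- READING 4 (never faithful): an infinite group has no injective homomorphism with finite image,
so for `n ≥ 3` no compressed linear shadow of the (infinite, see `LatticeRigidityWitnesses`)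
gate group `Γ_{2ⁿ}` is faithful. [cite: Margulis1991, Ch. VIII Theorems (B) and (C)] -/
theorem latticeRigidity_finiteImage.not_injective_of_infinite (h : latticeRigidity_finiteImage)
    {n d : ℕ} (hn : 3 ≤ n) (hd : d < 2 ^ n) [Infinite (toffoliHadamardGroup n)]
    (ρ : LinearShadow n d) : ¬ Function.Injective ρ := by
  intro hinj
  have hfin : Finite (Set.range ρ) := (h n hn d hd ρ).to_subtype
  have : Finite (toffoliHadamardGroup n) :=
    Finite.of_injective (fun x => (⟨ρ x, Set.mem_range_self x⟩ : Set.range ρ))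
      (fun x y hxy => hinj (congrArg Subtype.val hxy))
  exact not_finite (toffoliHadamardGroup n)

end Literature.Barriers.QuantumAdvantage

end
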